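import Summits.BirchSwinnertonDyer.BirchSwinnertonDyer.Theorems.CMKolyvaginAtInertTwoAdaptiveTelescopeStep
import HarnessLib

/-!
# Route `CMKolyvaginAtInertTwo`, crux `CMKolyvaginExactAtInertTwo` (stmt-BirchSwinnertonDyer-24277):
# THE ADAPTIVE SPLIT-FORM CASSELS–TATE TELESCOPE, II: `#Zp · #Zm ≤ p^{M₀}` (McCallum Thm. 5.4 "≤")

Seat `bsd-line-cmk2-p1` g13 (cell `bsd-print-cf2`); helper (`--supports stmt-BirchSwinnertonDyer-24277`).
THEOREMS ONLY: no definition, no named fact, no `sorry`; no item is closed; BSD is not proved by this.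
Sequel of `…AdaptiveTelescopeStep` (the single Kolyvagin prime). This file runs McCallum's induction
((16)–(23) of the proof of Thm. 5.4) in the ADAPTIVE split form fixed by seat g12's crux workfile
`Cruxes/CMExactDescentAtTwo/T4_SPEC_adaptive_telescope.lean` (T4 of `MEMO-T5-adaptive-splitting.md`;
KERNEL-STATUS-p2-port.md §11 items 6–7) and proves its statement (minus the idle hypothesis
`pΔ = 0`):

* `card_mul_card_mul_pow_le` — the induction. State: chain `n ∈ S_r`, used exponent `Sg`, ACTIVE
  pool `Act ≤ V^{ε(-1)^{r+1}}`, PASSIVE pool `Pas ≤ V^{ε(-1)^{r}}` (finite, inside the isotropic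
  `W ≤ Sel`, `Act` disjoint from `Pas ⊔ Δ` and `Pas` from `Act ⊔ Δ`), McCallum's (19)/(23) and the
  invariant (I) `p^i c(n) ∈ Act ⊔ Pas ⟹ (M - M₀) + Sg ≤ i`; conclusion
  `#Act · #Pas · p^{Sg} ≤ p^{M₀}`. One step = `adaptive_step` (a Kolyvagin prime `ℓ`, `Act = ⟨z⟩ ⊕ Z'`,
  `#Act = p^{e} #Z'`), after which the roles swap: new state `(Pas, Z')` at `ℓ n` with `Sg + e`;
  measure `2(#Act + #Pas) + [Act = ⊥]` (a step with `Act = ⊥` is the "dummy" prime `g₁ = 0`, which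
  only swaps the roles). End (`Act = Pas = ⊥`): (I) at `i = M` gives `Sg ≤ M₀`.
* `card_mul_card_le_of_casselsTate_adaptive` — **T4**: for two finite isotropic lift groups
  `Zp ≤ Sel ∩ V^{ε}`, `Zm ≤ Sel ∩ V^{-ε}` with `ℤx ⊓ (Zp ⊔ Zm) = ⊥`, **(IND)** `(Zp ⊔ Δ) ⊓ Zm = ⊥`
  (`Δ ≤ V` meeting both eigengroups trivially) and room `expo + M₀ ≤ M`, given the Cassels–Tate
  value `hCTV` (McCallum Prop. 4.7 + Lemma 5.3 + Prop. 4.4, order language, verbatim as in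
  `SplitHypothesesM.sum_expo_le_M₀_of_casselsTate_pure`) and the ORDER-form Čebotarev binder
  `hCeb₂` (Cor. 3.2 at `2` in the shape of `KolyvaginAdaptiveTwo.exists_characters_of_not_mem_add`):
  **`#Zp · #Zm ≤ p^{M₀}`** — initial state `n = 1`, `Sg = 0`, `Act = Zm`, `Pas = Zp`.

Reading at `p = 2` (the crux): `V = H¹(ℚ, E[2^M]) × H¹(ℚ, E^{(d_K)}[2^M])`, `Δ = Δ_H = ker(V → H¹(K, E[2^M]))`,
`Zp`, `Zm` lifts of maximal isotropic subgroups of `Ш(E^{±}/ℚ)[2^∞]` chosen to satisfy (IND) (T5′),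
`P` the two Cassels–Tate pairings; then `#Ш(E/ℚ)[2^∞] · #Ш(E^{(d_K)}/ℚ)[2^∞] ≤ 4^{M₀}` once the two
symplectic counts are made. What is NOT here: the discharge of `hCeb₂` on the habitat H₂ (T4c:
p668236/p670347 + p669091 + the regular `ℤ/2^M[τ]`-module `E[2^M]` + the local criterion), of `hCTV`,
and the choice of the lift groups (T5′).

References: [McCallumLMS1991] §5 Thm. 5.4 (proof, (16)–(23)), Cor. 5.6, Prop. 4.7, Lemma 5.3,
Prop. 3.1 / Cor. 3.2 (held `book:editornd-l-functions-arithmetic`, PDF pp. 280, 283–290).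
-/

-- single-conjunct summit: `Summit.BirchSwinnertonDyer.BirchSwinnertonDyer.…` repeats the name by design
set_option linter.dupNamespace false
set_option autoImplicit false

open scoped Classical

namespace Summit.BirchSwinnertonDyer.BirchSwinnertonDyer.Theorems.KolyvaginAdaptiveTwo

open Literature.NumberTheory.EllipticCurves Literature.NumberTheory.EllipticCurves.KolyvaginDescent

variable {V : Type*} [AddCommGroup V] {Pl : Type*} (S : SplitHypothesesM V Pl)

/-- `x` has order exactly `p^M`: `k • x = 0 ↔ p^M ∣ k`. [folklore] -/
private theorem zsmul_x_eq_zero_iff (k : ℤ) : k • S.x = 0 ↔ ((S.p : ℤ) ^ S.M) ∣ k :=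
  zsmul_eq_zero_iff_prime_pow_dvd S.hp (S.torsion S.x) S.x_ord k

/-! ## The chain `n_k = ℓ₁ ⋯ ℓ_k` with adaptive pools: McCallum's induction -/

/-- **McCallum 1991, proof of Thm. 5.4 — the chain with ADAPTIVE pools (induction on the measure
`2(#Act + #Pas) + [Act = ⊥]`).** In the setting of `card_mul_card_le_of_casselsTate_adaptive`
(isotropic `W ≤ Sel` with room `expo + M₀ ≤ M`, `Δ` pure-free, `hCTV`, `hCeb₂`): for every state —
finite pools `Act ≤ V^{ε(-1)^{r(n)+1}}`, `Pas ≤ V^{ε(-1)^{r(n)}}` in `W`, `Act` disjoint from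
`Pas ⊔ Δ` and `Pas` from `Act ⊔ Δ`, a chain `n` (`KolSupp`), a used exponent `Sg`, the pools vanishing
at the primes of `n` ((19)/(23)) and the invariant (I) `p^i c(n) ∈ Act ⊔ Pas ⟹ (M - M₀) + Sg ≤ i` —
one has **`#Act · #Pas · p^{Sg} ≤ p^{M₀}`**. Step: `adaptive_step`, then the roles of the pools swap.
[cite: McCallumLMS1991, §5 Thm. 5.4 (proof, (16)–(23)), Cor. 5.6 (PDF pp. 288–290)] -/
theorem card_mul_card_mul_pow_le {R : Type*} [AddCommGroup R] (P : S.Sel →+ S.Sel →+ R)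
    (hCTV : ∀ ℓ m : ℕ, S.Kol ℓ → KolSupp S.Kol (ℓ * m) → ¬ ℓ ∣ m →
      ∀ (j N a b : ℕ) (t : V) (ht : t ∈ S.Sel) (hz : ((S.p : ℤ) ^ j) • S.c (ℓ * m) ∈ S.Sel),
      ((S.p : ℤ) ^ N) • t = 0 → t ∈ S.eig (S.ε * (-1) ^ (ℓ * m).primeFactors.card) →
      (∀ q ∈ m.primeFactors, t ∈ S.A q) → S.M - S.M₀ ≤ j → N + S.M₀ ≤ S.M → N ≤ j → a + b + 1 = N →
      ((S.p : ℤ) ^ (a + (j - N))) • S.c m ∉ S.A ℓ → ((S.p : ℤ) ^ b) • t ∉ S.A ℓ →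
      P ⟨_, hz⟩ ⟨t, ht⟩ ≠ 0)
    (Δ : AddSubgroup V)
    (hΔpure : ∀ d ∈ Δ, ∀ e : ℤ, (e = 1 ∨ e = -1) → d ∈ S.eig e → d = 0)
    (hCeb₂ : ∀ (T : Finset V) (g₁ g₂ : V) (ν : ℤ) (I : ℕ), (ν = 1 ∨ ν = -1) → g₁ ∈ S.eig ν →
      g₂ ∈ S.eig (-ν) → (∀ t ∈ T, ∃ e : ℤ, (e = 1 ∨ e = -1) ∧ t ∈ S.eig e) →
      (g₁ ≠ 0 → ((S.p : ℤ) ^ (S.expo g₁ - 1)) • g₁ ∉ Δ ⊔ AddSubgroup.closure (T : Set V)) →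
      (1 ≤ I → ∀ d ∈ Δ, ∀ u ∈ AddSubgroup.closure (T : Set V), u ∈ S.eig (-ν) →
        ∀ v ∈ AddSubgroup.closure (T : Set V), v ∈ S.eig ν → (S.p : ℤ) • v = 0 →
        ((S.p : ℤ) ^ (I - 1)) • g₂ ≠ d + u + v) →
      ∀ b : ℕ, ∃ ℓ, b < ℓ ∧ S.Kol ℓ ∧
        (∀ t ∈ AddSubgroup.closure (T : Set V), t ∈ S.A ℓ) ∧
        (∀ j < S.expo g₁, ((S.p : ℤ) ^ j) • g₁ ∉ S.A ℓ) ∧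
        (∀ i < I, ((S.p : ℤ) ^ i) • g₂ ∉ S.A ℓ))
    (W : AddSubgroup V) (hWSel : W ≤ S.Sel)
    (hiso : ∀ u, ∀ hu : u ∈ W, ∀ v, ∀ hv : v ∈ W, ∀ (hu' : u ∈ S.Sel) (hv' : v ∈ S.Sel),
      P ⟨u, hu'⟩ ⟨v, hv'⟩ = 0)
    (hroom : ∀ z ∈ W, S.expo z + S.M₀ ≤ S.M) :
    ∀ (m : ℕ) (Act Pas : AddSubgroup V) [Finite Act] [Finite Pas], Act ≤ W → Pas ≤ W →
      Disjoint Act (Pas ⊔ Δ) → Disjoint Pas (Act ⊔ Δ) →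
      ∀ n : ℕ, KolSupp S.Kol n → ∀ Sg : ℕ,
      (∀ z ∈ Act, z ∈ S.eig (S.ε * (-1) ^ (n.primeFactors.card + 1))) →
      (∀ u ∈ Pas, u ∈ S.eig (S.ε * (-1) ^ n.primeFactors.card)) →
      (∀ q ∈ n.primeFactors, ∀ z ∈ Act ⊔ Pas, z ∈ S.A q) →
      (∀ i : ℕ, ((S.p : ℤ) ^ i) • S.c n ∈ Act ⊔ Pas → (S.M - S.M₀) + Sg ≤ i) →
      2 * (Nat.card Act + Nat.card Pas) + (if Act = ⊥ then 1 else 0) ≤ m →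
      Nat.card Act * Nat.card Pas * S.p ^ Sg ≤ S.p ^ S.M₀ := by
  have hp := S.hp
  intro m
  induction m with
  | zero =>
    intro Act Pas _ _ _ _ _ _ n _ Sg _ _ _ _ hm
    have : 0 < Nat.card Act := Nat.card_pos
    omega
  | succ m ih =>
    intro Act Pas _ _ hAct hPas hd1 hd2 n hn Sg hActν hPasν hA hI hm
    by_cases hend : Act = ⊥ ∧ Pas = ⊥
    · -- END: both pools exhausted; (I) at `i = M` gives `Sg ≤ M₀`
      obtain ⟨hA0, hP0⟩ := hend
      have hSg : S.M - S.M₀ + Sg ≤ S.M := hI S.M (by rw [S.torsion]; exact zero_mem _)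
      have hcA : Nat.card Act = 1 := by rw [hA0]; exact AddSubgroup.card_bot
      have hcP : Nat.card Pas = 1 := by rw [hP0]; exact AddSubgroup.card_bot
      rw [hcA, hcP, one_mul, one_mul]
      exact Nat.pow_le_pow_right hp.pos (by omega)
    · -- one Kolyvagin prime (`adaptive_step`), then recurse with the roles of the pools swapped
      obtain ⟨ℓ, Z', e, -, hsupp, hcard', hZ'le, hcardAct, hene, hA', hI'⟩ :=
        adaptive_step S P hCTV Δ hΔpure hCeb₂ W hWSel hiso hroom Act Pas hAct hPas hd1 hn Sg hActν
          hPasν hA hI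
      haveI : Finite Z' :=
        Finite.of_injective (AddSubgroup.inclusion hZ'le) (AddSubgroup.inclusion_injective hZ'le)
      -- the new state `(Pas, Z')` at `ℓ n` with `Sg + e`
      have hd1' : Disjoint Pas (Z' ⊔ Δ) := hd2.mono_right (sup_le_sup_right hZ'le Δ)
      have hd2' : Disjoint Z' (Pas ⊔ Δ) := hd1.mono_left hZ'le
      have hActν' : ∀ z ∈ Pas, z ∈ S.eig (S.ε * (-1) ^ ((ℓ * n).primeFactors.card + 1)) := by
        intro z hz
        have : S.ε * (-1) ^ ((ℓ * n).primeFactors.card + 1) = S.ε * (-1) ^ n.primeFactors.card := by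
          rw [hcard']
          ring
        rw [this]
        exact hPasν z hz
      have hPasν' : ∀ u ∈ Z', u ∈ S.eig (S.ε * (-1) ^ (ℓ * n).primeFactors.card) := by
        intro u hu
        rw [hcard']
        exact hActν u (hZ'le hu)
      have hAI : ∀ q ∈ (ℓ * n).primeFactors, ∀ z ∈ Pas ⊔ Z', z ∈ S.A q := by
        intro q hq z hz
        rw [sup_comm] at hz
        exact hA' q hq z hz
      have hII : ∀ i : ℕ, ((S.p : ℤ) ^ i) • S.c (ℓ * n) ∈ Pas ⊔ Z' →
          (S.M - S.M₀) + (Sg + e) ≤ i := by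
        intro i hi
        rw [sup_comm] at hi
        exact hI' i hi
      -- the measure drops
      have hcZ' : 0 < Nat.card Z' := Nat.card_pos
      have hmeas : 2 * (Nat.card Pas + Nat.card Z') + (if Pas = ⊥ then 1 else 0) ≤ m := by
        by_cases hA0 : Act = ⊥
        · -- dummy step: the roles swap, `[Act = ⊥]` drops
          have hP0 : Pas ≠ ⊥ := fun h ↦ hend ⟨hA0, h⟩
          have hcA : Nat.card Act = 1 := by rw [hA0]; exact AddSubgroup.card_bot
          have hZ'bot : Z' = ⊥ := by rw [← le_bot_iff, ← hA0]; exact hZ'le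
          have hcZ : Nat.card Z' = 1 := by rw [hZ'bot]; exact AddSubgroup.card_bot
          rw [if_pos hA0] at hm
          rw [if_neg hP0]
          omega
        · -- real step: `#Z' ≤ #Act / p`
          have he : e ≠ 0 := hene hA0
          have h2 : 2 * Nat.card Z' ≤ Nat.card Act := by
            rw [hcardAct]
            exact Nat.mul_le_mul_right _ (Nat.succ_le_of_lt (Nat.one_lt_pow he hp.one_lt))
          rw [if_neg hA0] at hm
          split_ifs <;> omega
      have hrec := ih Pas Z' hPas (hZ'le.trans hAct) hd1' hd2' (ℓ * n) hsupp (Sg + e) hActν' hPasν'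
        hAI hII hmeas
      calc Nat.card Act * Nat.card Pas * S.p ^ Sg
          = Nat.card Pas * Nat.card Z' * S.p ^ (Sg + e) := by rw [hcardAct, pow_add]; ring
        _ ≤ S.p ^ S.M₀ := hrec

/-! ## Kolyvagin's inequality with adaptive lift groups: `#Zp · #Zm ≤ p^{M₀}` -/

/-- **T4 — McCallum 1991 Thm. 5.4 "≤" / Cor. 5.6 in telescope form, split currency, ADAPTIVE
version (crux workfile `T4_SPEC_adaptive_telescope.lean` of seat g12, without its idle hypothesis
`pΔ = 0`).** Let `S` be the split descent data modulo `p^M` (any prime `p`), `P` a bi-additive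
pairing on `Sel` (the Cassels–Tate pairing pulled back), `Δ ≤ V` a subgroup meeting both
eigengroups trivially (at `2` on the pair `(E, E^{d_K})`: `Δ_H = ker(V → H¹(K, E[2^M]))`), and
`Zp ≤ Sel ∩ V^{ε}`, `Zm ≤ Sel ∩ V^{-ε}` two FINITE ISOTROPIC LIFT GROUPS, independent of `ℤx`
(`ℤx ⊓ (Zp ⊔ Zm) = ⊥`), satisfying **(IND)** `(Zp ⊔ Δ) ⊓ Zm = ⊥`, with room `expo z + M₀ ≤ M`.
Assume McCallum's Prop. 4.7 / Lemma 5.3 / Prop. 4.4 in order language (`hCTV`, verbatim as in the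
tree's `sum_expo_le_M₀_of_casselsTate_pure`) and Čebotarev (Prop. 3.1 / Cor. 3.2) in ORDER form with
the `p = 2`-correct bottoms hypotheses (`hCeb₂`: pool `⟨T⟩` zero at `λ`, `g₁` full at `λ` provided its
bottom avoids `Δ ⊔ ⟨T⟩`, `g₂` of local order `≥ p^I` provided `p^{I-1} g₂ ∉ Δ + ⟨T⟩_{-ν} + ⟨T⟩_{ν}[p]`).
Then **`#Zp · #Zm ≤ p^{M₀}`** (`= ∑ Nᵢ ≤ M₀` for independent generators; for lifts of maximal
isotropic subgroups of the two `Ш[p^∞]`: `#Ш⁺ · #Ш⁻ ≤ p^{2M₀}`). Proof: `card_mul_card_mul_pow_le`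
from the initial state `n = 1`, `Sg = 0`, `Act = Zm`, `Pas = Zp` ((I) there is the independence of
`ℤx`). [cite: McCallumLMS1991, §1 Theorem; §5 Thm. 5.4 (proof, (16)–(23)), Cor. 5.6; Prop. 3.1 / Cor. 3.2, Prop. 4.7, Lemma 5.3 (PDF pp. 280, 283–290)] -/
theorem card_mul_card_le_of_casselsTate_adaptive {R : Type*} [AddCommGroup R]
    (P : S.Sel →+ S.Sel →+ R)
    (hCTV : ∀ ℓ m : ℕ, S.Kol ℓ → KolSupp S.Kol (ℓ * m) → ¬ ℓ ∣ m →
      ∀ (j N a b : ℕ) (t : V) (ht : t ∈ S.Sel) (hz : ((S.p : ℤ) ^ j) • S.c (ℓ * m) ∈ S.Sel),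
      ((S.p : ℤ) ^ N) • t = 0 → t ∈ S.eig (S.ε * (-1) ^ (ℓ * m).primeFactors.card) →
      (∀ q ∈ m.primeFactors, t ∈ S.A q) → S.M - S.M₀ ≤ j → N + S.M₀ ≤ S.M → N ≤ j → a + b + 1 = N →
      ((S.p : ℤ) ^ (a + (j - N))) • S.c m ∉ S.A ℓ → ((S.p : ℤ) ^ b) • t ∉ S.A ℓ →
      P ⟨_, hz⟩ ⟨t, ht⟩ ≠ 0)
    (Δ : AddSubgroup V)
    (hΔpure : ∀ d ∈ Δ, ∀ e : ℤ, (e = 1 ∨ e = -1) → d ∈ S.eig e → d = 0)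
    (hCeb₂ : ∀ (T : Finset V) (g₁ g₂ : V) (ν : ℤ) (I : ℕ), (ν = 1 ∨ ν = -1) → g₁ ∈ S.eig ν →
      g₂ ∈ S.eig (-ν) → (∀ t ∈ T, ∃ e : ℤ, (e = 1 ∨ e = -1) ∧ t ∈ S.eig e) →
      (g₁ ≠ 0 → ((S.p : ℤ) ^ (S.expo g₁ - 1)) • g₁ ∉ Δ ⊔ AddSubgroup.closure (T : Set V)) →
      (1 ≤ I → ∀ d ∈ Δ, ∀ u ∈ AddSubgroup.closure (T : Set V), u ∈ S.eig (-ν) →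
        ∀ v ∈ AddSubgroup.closure (T : Set V), v ∈ S.eig ν → (S.p : ℤ) • v = 0 →
        ((S.p : ℤ) ^ (I - 1)) • g₂ ≠ d + u + v) →
      ∀ b : ℕ, ∃ ℓ, b < ℓ ∧ S.Kol ℓ ∧
        (∀ t ∈ AddSubgroup.closure (T : Set V), t ∈ S.A ℓ) ∧
        (∀ j < S.expo g₁, ((S.p : ℤ) ^ j) • g₁ ∉ S.A ℓ) ∧
        (∀ i < I, ((S.p : ℤ) ^ i) • g₂ ∉ S.A ℓ))
    (Zp Zm : AddSubgroup V) [Finite Zp] [Finite Zm]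
    (hZp : ∀ z ∈ Zp, z ∈ S.Sel ∧ z ∈ S.eig S.ε) (hZm : ∀ z ∈ Zm, z ∈ S.Sel ∧ z ∈ S.eig (-S.ε))
    (hiso : ∀ u, ∀ hu : u ∈ Zp ⊔ Zm, ∀ v, ∀ hv : v ∈ Zp ⊔ Zm, ∀ (hu' : u ∈ S.Sel) (hv' : v ∈ S.Sel),
      P ⟨u, hu'⟩ ⟨v, hv'⟩ = 0)
    (hind : AddSubgroup.zmultiples S.x ⊓ (Zp ⊔ Zm) = ⊥)
    (hIND : (Zp ⊔ Δ) ⊓ Zm = ⊥)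
    (hroom : ∀ z ∈ Zp ⊔ Zm, S.expo z + S.M₀ ≤ S.M) :
    Nat.card Zp * Nat.card Zm ≤ S.p ^ S.M₀ := by
  have hp := S.hp
  have hWSel : Zp ⊔ Zm ≤ S.Sel := sup_le (fun z hz ↦ (hZp z hz).1) (fun z hz ↦ (hZm z hz).1)
  -- (IND) in the two forms the induction carries (`Δ ∩ V^{ε} = 0`)
  have hd1 : Disjoint Zm (Zp ⊔ Δ) := by rw [disjoint_iff, inf_comm]; exact hIND
  have hd2 : Disjoint Zp (Zm ⊔ Δ) := by
    refine AddSubgroup.disjoint_def.mpr fun {a} haP haMD ↦ ?_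
    obtain ⟨b, hb, d, hd, hbd⟩ := AddSubgroup.mem_sup.mp haMD
    have hb' : b ∈ (Zp ⊔ Δ) ⊓ Zm := by
      refine ⟨?_, hb⟩
      have : b = a - d := by rw [← hbd]; abel
      rw [this]
      exact (Zp ⊔ Δ).sub_mem (AddSubgroup.mem_sup_left haP) (AddSubgroup.mem_sup_right hd)
    rw [hIND, AddSubgroup.mem_bot] at hb'
    rw [hb', zero_add] at hbd
    subst hbd
    exact hΔpure d hd S.ε S.hε (hZp d haP).2
  -- ### initial state: `n = 1`, `Sg = 0`, `Act = Zm` (sign `-ε`), `Pas = Zp` (sign `ε`)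
  have hActν : ∀ z ∈ Zm, z ∈ S.eig (S.ε * (-1) ^ ((1 : ℕ).primeFactors.card + 1)) := by
    intro z hz
    rw [Nat.primeFactors_one, Finset.card_empty, zero_add, pow_one, mul_neg_one]
    exact (hZm z hz).2
  have hPasν : ∀ u ∈ Zp, u ∈ S.eig (S.ε * (-1) ^ (1 : ℕ).primeFactors.card) := by
    intro u hu
    rw [Nat.primeFactors_one, Finset.card_empty, pow_zero, mul_one]
    exact (hZp u hu).2
  have hA : ∀ q ∈ (1 : ℕ).primeFactors, ∀ z ∈ Zm ⊔ Zp, z ∈ S.A q := by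
    intro q hq
    simp at hq
  -- (I) at `n = 1`: `p^{i + M₀} x ∈ Zp ⊔ Zm ⟹ p^{i + M₀} x = 0 ⟹ M ≤ i + M₀` (independence of `ℤx`)
  have hI : ∀ i : ℕ, ((S.p : ℤ) ^ i) • S.c 1 ∈ Zm ⊔ Zp → (S.M - S.M₀) + 0 ≤ i := by
    intro i hi
    rw [S.c_one, smul_smul, ← pow_add, sup_comm] at hi
    have hmem : ((S.p : ℤ) ^ (i + S.M₀)) • S.x ∈ AddSubgroup.zmultiples S.x ⊓ (Zp ⊔ Zm) :=
      ⟨AddSubgroup.zsmul_mem _ (AddSubgroup.mem_zmultiples S.x) _, hi⟩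
    rw [hind, AddSubgroup.mem_bot, zsmul_x_eq_zero_iff S, ← Nat.cast_pow, ← Nat.cast_pow,
      Int.natCast_dvd_natCast, Nat.pow_dvd_pow_iff_le_right hp.one_lt] at hmem
    omega
  have key := card_mul_card_mul_pow_le S P hCTV Δ hΔpure hCeb₂ (Zp ⊔ Zm) hWSel hiso hroom _ Zm Zp
    le_sup_right le_sup_left hd1 hd2 1 (kolSupp_one _) 0 hActν hPasν hA hI le_rfl
  rw [pow_zero, mul_one, mul_comm] at key
  exact key

end Summit.BirchSwinnertonDyer.BirchSwinnertonDyer.Theorems.KolyvaginAdaptiveTwo
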